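import Summits.AtomisticToContinuum.HydrodynamicLimit.Theorems.ImplosionDichotomyPolynomialCompressionUniqueness

/-!
# Pointwise bounds of the rescaled hard-sphere law `ζ(r) = Z(rσ³)` at small packing

Helper file for the line `log-lipschitz-budget` of the crux `ImplosionDichotomy.PolynomialCompression`
(stmt-AtomisticToContinuum-12587), stub `stub_logBudgetShadowing` (blueprint §2–3: the equation-of-state
values `ζ(ρ) − 1`, `ρζ'(ρ)`, `ρ²ζ''(ρ)` are all `O(packing)`). Under the unbundled low-density
hypotheses of the skeleton (`F` analytic on `(-η₀, η₀)` with `hsExcessFreeEnergy = F` on `[0, η₀)`), put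
`Zf η = 1 + η F'(η)` and, for a reduced diameter `σ > 0`, `ζ(r) = Zf (rσ³)` on the open set
`J = {r | rσ³ ∈ (-η₀, η₀)}`. Then `ζ` is smooth on `J`, it IS the pressure law of every classical
solution with packing `< η₀` (`hsPressure σ ρ θ = ρ θ ζ(ρ)`), and there are `η₂ ∈ (0, η₀)` and `c_Z ≥ 0`,
depending only on `(η₀, F)`, with `|ζ(r) − 1|, |r ζ'(r)|, |r² ζ''(r)| ≤ c_Z · rσ³` whenever `0 ≤ rσ³ ≤ η₂`.
-/

noncomputable section

namespace Summit.AtomisticToContinuum.HydrodynamicLimit.Theorems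

open Set Filter Topology MeasureTheory
open scoped ContDiff
open Literature.MathematicalPhysics.KineticTheory Literature.Analysis.FunctionSpaces

/-- A function continuous on a compact interval is bounded in absolute value there. [folklore] -/
theorem exists_abs_le_of_continuousOn_Icc {g : ℝ → ℝ} {a b : ℝ} (hg : ContinuousOn g (Icc a b)) :
    ∃ M : ℝ, 0 ≤ M ∧ ∀ η ∈ Icc a b, |g η| ≤ M := by
  obtain ⟨M, hM⟩ := (isCompact_Icc (a := a) (b := b)).exists_bound_of_continuousOn hg
  exact ⟨max M 0, le_max_right _ _, fun η hη => (Real.norm_eq_abs _ ▸ hM η hη).trans (le_max_left _ _)⟩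

/-- **Small-packing bounds of the rescaled hard-sphere law.** See the module docstring: smoothness of
`ζ = Zf(·σ³)` on `J`, the pressure identity for classical solutions with packing `< η₀`, and the three
`O(packing)` bounds with constants independent of `σ`. [folklore] -/
theorem hsEos_rescaled_bounds :
    ∀ η₀ : ℝ, 0 < η₀ → ∀ F : ℝ → ℝ, AnalyticOnNhd ℝ F (Ioo (-η₀) η₀) →
      EqOn hsExcessFreeEnergy F (Ico 0 η₀) →
      ∃ η₂ cZ : ℝ, 0 < η₂ ∧ η₂ < η₀ ∧ 0 ≤ cZ ∧ ∀ σ : ℝ, 0 < σ →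
        IsOpen ((fun r : ℝ => r * σ ^ 3) ⁻¹' Ioo (-η₀) η₀) ∧
        ContDiffOn ℝ (⊤ : ℕ∞) (fun r => 1 + r * σ ^ 3 * deriv F (r * σ ^ 3))
          ((fun r : ℝ => r * σ ^ 3) ⁻¹' Ioo (-η₀) η₀) ∧
        (∀ (T : ℝ) (ρ θ : ℝ → T3 → ℝ) (u : ℝ → T3 → V3), IsHardSphereEulerSolution σ T ρ u θ →
          (∀ t ∈ Ico 0 T, ∀ x, ρ t x * σ ^ 3 < η₀) →
          (∀ t ∈ Ico 0 T, ∀ x, ρ t x ∈ (fun r : ℝ => r * σ ^ 3) ⁻¹' Ioo (-η₀) η₀) ∧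
          ∀ t ∈ Ico 0 T, ∀ x, hsPressure σ (ρ t x) (θ t x) =
            ρ t x * θ t x * (fun r => 1 + r * σ ^ 3 * deriv F (r * σ ^ 3)) (ρ t x)) ∧
        ∀ r : ℝ, 0 ≤ r → r * σ ^ 3 ≤ η₂ →
          |(fun r => 1 + r * σ ^ 3 * deriv F (r * σ ^ 3)) r - 1| ≤ cZ * (r * σ ^ 3) ∧
          |r * deriv (fun r => 1 + r * σ ^ 3 * deriv F (r * σ ^ 3)) r| ≤ cZ * (r * σ ^ 3) ∧
          |r ^ 2 * deriv (deriv (fun r => 1 + r * σ ^ 3 * deriv F (r * σ ^ 3))) r| ≤ cZ * (r * σ ^ 3) := by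
  intro η₀ hη₀ F hF hEq
  have hFc : ContDiffOn ℝ ∞ F (Ioo (-η₀) η₀) := hF.contDiffOn_of_completeSpace
  -- the derivatives of `F` on the open interval
  have hF1 : ContDiffOn ℝ ∞ (deriv F) (Ioo (-η₀) η₀) := hFc.deriv_of_isOpen isOpen_Ioo le_rfl
  have hF2 : ContDiffOn ℝ ∞ (deriv (deriv F)) (Ioo (-η₀) η₀) := hF1.deriv_of_isOpen isOpen_Ioo le_rfl
  have hF3 : ContDiffOn ℝ ∞ (deriv (deriv (deriv F))) (Ioo (-η₀) η₀) :=
    hF2.deriv_of_isOpen isOpen_Ioo le_rfl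
  -- uniform bounds on the compact `[0, η₀/2]`
  have hsub : Icc 0 (η₀ / 2) ⊆ Ioo (-η₀) η₀ := fun η hη => ⟨by linarith [hη.1], by linarith [hη.2]⟩
  obtain ⟨M₁, hM₁, hB₁⟩ := exists_abs_le_of_continuousOn_Icc (hF1.continuousOn.mono hsub)
  obtain ⟨M₂, hM₂, hB₂⟩ := exists_abs_le_of_continuousOn_Icc (hF2.continuousOn.mono hsub)
  obtain ⟨M₃, hM₃, hB₃⟩ := exists_abs_le_of_continuousOn_Icc (hF3.continuousOn.mono hsub)
  refine ⟨η₀ / 2, M₁ + η₀ * M₂ + η₀ ^ 2 * M₃, by positivity, by linarith, by positivity, ?_⟩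
  intro σ hσ
  have hσ3 : 0 < σ ^ 3 := pow_pos hσ 3
  set Zf : ℝ → ℝ := fun η => 1 + η * deriv F η with hZf
  have hZc : ContDiffOn ℝ ∞ Zf (Ioo (-η₀) η₀) :=
    contDiffOn_const.add (contDiffOn_id.mul hF1)
  have hJo : IsOpen ((fun r : ℝ => r * σ ^ 3) ⁻¹' Ioo (-η₀) η₀) :=
    isOpen_Ioo.preimage (continuous_id.mul continuous_const)
  have hζeq : (fun r => 1 + r * σ ^ 3 * deriv F (r * σ ^ 3)) = fun r => Zf (r * σ ^ 3) := by
    funext r; simp [hZf]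
  refine ⟨hJo, ?_, ?_, ?_⟩
  · -- smoothness of `ζ`
    rw [hζeq]
    exact hZc.comp (contDiffOn_id.mul contDiffOn_const) fun r hr => hr
  · -- the pressure law of a classical solution with packing `< η₀`
    intro T ρ θ u hE hpk
    refine ⟨fun t ht x => ?_, fun t ht x => ?_⟩
    · show ρ t x * σ ^ 3 ∈ Ioo (-η₀) η₀
      exact ⟨by nlinarith [mul_pos (hE.density_pos t ht x) hσ3], hpk t ht x⟩
    · have hη : ρ t x * σ ^ 3 ∈ Ioo 0 η₀ := ⟨mul_pos (hE.density_pos t ht x) hσ3, hpk t ht x⟩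
      show ρ t x * θ t x * hsCompressibility (ρ t x * σ ^ 3) =
        ρ t x * θ t x * (1 + ρ t x * σ ^ 3 * deriv F (ρ t x * σ ^ 3))
      rw [hsCompressibility_eq_of_eqOn hEq hη]
  · -- the three `O(packing)` bounds
    intro r hr hrη
    have hη0 : 0 ≤ r * σ ^ 3 := mul_nonneg hr hσ3.le
    have hηmem : r * σ ^ 3 ∈ Icc 0 (η₀ / 2) := ⟨hη0, hrη⟩
    have hηI : r * σ ^ 3 ∈ Ioo (-η₀) η₀ := hsub hηmem
    -- derivatives of `F`, `F'`, `F''` at `η`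
    have dF1 : HasDerivAt (deriv F) (deriv (deriv F) (r * σ ^ 3)) (r * σ ^ 3) :=
      ((hF1.differentiableOn (by simp)).differentiableAt (isOpen_Ioo.mem_nhds hηI)).hasDerivAt
    have dF2 : HasDerivAt (deriv (deriv F)) (deriv (deriv (deriv F)) (r * σ ^ 3)) (r * σ ^ 3) :=
      ((hF2.differentiableOn (by simp)).differentiableAt (isOpen_Ioo.mem_nhds hηI)).hasDerivAt
    -- the rescaling map
    have hl : ∀ s : ℝ, HasDerivAt (fun r : ℝ => r * σ ^ 3) (σ ^ 3) s := fun s => by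
      simpa using (hasDerivAt_id s).mul_const (σ ^ 3)
    -- first derivative of `ζ`: `ζ'(s) = σ³ (F'(sσ³) + sσ³ F''(sσ³))` near `r`
    have hζ' : ∀ s : ℝ, s * σ ^ 3 ∈ Ioo (-η₀) η₀ →
        HasDerivAt (fun r => 1 + r * σ ^ 3 * deriv F (r * σ ^ 3))
          (σ ^ 3 * deriv F (s * σ ^ 3) + s * σ ^ 3 * (deriv (deriv F) (s * σ ^ 3) * σ ^ 3)) s := by
      intro s hs
      have d1 : HasDerivAt (deriv F) (deriv (deriv F) (s * σ ^ 3)) (s * σ ^ 3) :=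
        ((hF1.differentiableOn (by simp)).differentiableAt (isOpen_Ioo.mem_nhds hs)).hasDerivAt
      have d1c : HasDerivAt (fun r => deriv F (r * σ ^ 3)) (deriv (deriv F) (s * σ ^ 3) * σ ^ 3) s := by
        have := HasDerivAt.comp s d1 (hl s)
        simpa [Function.comp_def] using this
      have := ((hl s).mul d1c).const_add 1
      simpa [mul_comm, mul_left_comm, mul_assoc, add_comm, add_left_comm] using this
    have hderiv_eq : ∀ s : ℝ, s * σ ^ 3 ∈ Ioo (-η₀) η₀ →
        deriv (fun r => 1 + r * σ ^ 3 * deriv F (r * σ ^ 3)) s =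
          σ ^ 3 * deriv F (s * σ ^ 3) + s * σ ^ 3 * (deriv (deriv F) (s * σ ^ 3) * σ ^ 3) :=
      fun s hs => (hζ' s hs).deriv
    -- the derivative formula holds on a neighbourhood of `r`, so we may differentiate it again
    have hnhds : ∀ᶠ s in 𝓝 r, s * σ ^ 3 ∈ Ioo (-η₀) η₀ :=
      (continuous_id.mul continuous_const).continuousAt.preimage_mem_nhds (isOpen_Ioo.mem_nhds hηI)
    have hev : deriv (fun r => 1 + r * σ ^ 3 * deriv F (r * σ ^ 3)) =ᶠ[𝓝 r]
        fun s => σ ^ 3 * deriv F (s * σ ^ 3) + s * σ ^ 3 * (deriv (deriv F) (s * σ ^ 3) * σ ^ 3) :=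
      hnhds.mono fun s hs => hderiv_eq s hs
    have d1c : HasDerivAt (fun s => deriv F (s * σ ^ 3)) (deriv (deriv F) (r * σ ^ 3) * σ ^ 3) r := by
      have := HasDerivAt.comp r dF1 (hl r)
      simpa [Function.comp_def] using this
    have d2c : HasDerivAt (fun s => deriv (deriv F) (s * σ ^ 3))
        (deriv (deriv (deriv F)) (r * σ ^ 3) * σ ^ 3) r := by
      have := HasDerivAt.comp r dF2 (hl r)
      simpa [Function.comp_def] using this
    have hζ'' := (d1c.const_mul (σ ^ 3)).add ((hl r).mul (d2c.mul_const (σ ^ 3)))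
    have hderiv2 : deriv (deriv (fun r => 1 + r * σ ^ 3 * deriv F (r * σ ^ 3))) r =
        σ ^ 3 * (deriv (deriv F) (r * σ ^ 3) * σ ^ 3) +
          (σ ^ 3 * (deriv (deriv F) (r * σ ^ 3) * σ ^ 3) +
            r * σ ^ 3 * (deriv (deriv (deriv F)) (r * σ ^ 3) * σ ^ 3 * σ ^ 3)) := by
      rw [Filter.EventuallyEq.deriv_eq hev]; exact hζ''.deriv
    have b1 := hB₁ (r * σ ^ 3) hηmem
    have b2 := hB₂ (r * σ ^ 3) hηmem
    have b3 := hB₃ (r * σ ^ 3) hηmem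
    have hη₀2 : r * σ ^ 3 ≤ η₀ := by linarith [hηmem.2]
    beta_reduce
    refine ⟨?_, ?_, ?_⟩
    · -- `|ζ(r) - 1| = η |F'(η)| ≤ M₁ η`
      have : (1 + r * σ ^ 3 * deriv F (r * σ ^ 3)) - 1 = (r * σ ^ 3) * deriv F (r * σ ^ 3) := by ring
      rw [this, abs_mul, abs_of_nonneg hη0]
      nlinarith [abs_nonneg (deriv F (r * σ ^ 3)), mul_nonneg hη0 hM₂, mul_nonneg hη0 hM₃,
        mul_nonneg (mul_nonneg hη0 hη₀.le) hM₂, mul_nonneg (mul_nonneg hη0 (sq_nonneg η₀)) hM₃]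
    · -- `|r ζ'(r)| = |η F'(η) + η² F''(η)| ≤ (M₁ + η₀ M₂) η`
      rw [hderiv_eq r hηI]
      have : r * (σ ^ 3 * deriv F (r * σ ^ 3) + r * σ ^ 3 * (deriv (deriv F) (r * σ ^ 3) * σ ^ 3)) =
          (r * σ ^ 3) * (deriv F (r * σ ^ 3) + (r * σ ^ 3) * deriv (deriv F) (r * σ ^ 3)) := by ring
      rw [this, abs_mul, abs_of_nonneg hη0]
      have h1 : |deriv F (r * σ ^ 3) + (r * σ ^ 3) * deriv (deriv F) (r * σ ^ 3)| ≤ M₁ + η₀ * M₂ := by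
        calc |deriv F (r * σ ^ 3) + (r * σ ^ 3) * deriv (deriv F) (r * σ ^ 3)|
            ≤ |deriv F (r * σ ^ 3)| + |(r * σ ^ 3) * deriv (deriv F) (r * σ ^ 3)| := abs_add_le _ _
          _ = |deriv F (r * σ ^ 3)| + (r * σ ^ 3) * |deriv (deriv F) (r * σ ^ 3)| := by
              rw [abs_mul (r * σ ^ 3), abs_of_nonneg hη0]
          _ ≤ M₁ + η₀ * M₂ := add_le_add b1 (mul_le_mul hη₀2 b2 (abs_nonneg _) hη₀.le)
      calc (r * σ ^ 3) * |deriv F (r * σ ^ 3) + (r * σ ^ 3) * deriv (deriv F) (r * σ ^ 3)|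
          ≤ (r * σ ^ 3) * (M₁ + η₀ * M₂) := mul_le_mul_of_nonneg_left h1 hη0
        _ ≤ (M₁ + η₀ * M₂ + η₀ ^ 2 * M₃) * (r * σ ^ 3) := by
            nlinarith [mul_nonneg (mul_nonneg (sq_nonneg η₀) hM₃) hη0]
    · -- `|r² ζ''(r)| = |2η² F''(η) + η³ F'''(η)| ≤ η (2η M₂ + η² M₃) ≤ η (η₀ M₂ + η₀² M₃)`
      rw [hderiv2]
      have : r ^ 2 * (σ ^ 3 * (deriv (deriv F) (r * σ ^ 3) * σ ^ 3) +
          (σ ^ 3 * (deriv (deriv F) (r * σ ^ 3) * σ ^ 3) +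
            r * σ ^ 3 * (deriv (deriv (deriv F)) (r * σ ^ 3) * σ ^ 3 * σ ^ 3))) =
          (r * σ ^ 3) * (2 * (r * σ ^ 3) * deriv (deriv F) (r * σ ^ 3) +
            (r * σ ^ 3) ^ 2 * deriv (deriv (deriv F)) (r * σ ^ 3)) := by ring
      rw [this, abs_mul (r * σ ^ 3), abs_of_nonneg hη0]
      have h2η : 2 * (r * σ ^ 3) ≤ η₀ := by linarith [hηmem.2]
      have hη2 : (r * σ ^ 3) ^ 2 ≤ η₀ ^ 2 := by nlinarith
      have h1 : |2 * (r * σ ^ 3) * deriv (deriv F) (r * σ ^ 3) +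
          (r * σ ^ 3) ^ 2 * deriv (deriv (deriv F)) (r * σ ^ 3)| ≤ η₀ * M₂ + η₀ ^ 2 * M₃ := by
        calc |2 * (r * σ ^ 3) * deriv (deriv F) (r * σ ^ 3) +
              (r * σ ^ 3) ^ 2 * deriv (deriv (deriv F)) (r * σ ^ 3)|
            ≤ |2 * (r * σ ^ 3) * deriv (deriv F) (r * σ ^ 3)| +
                |(r * σ ^ 3) ^ 2 * deriv (deriv (deriv F)) (r * σ ^ 3)| := abs_add_le _ _
          _ = 2 * (r * σ ^ 3) * |deriv (deriv F) (r * σ ^ 3)| +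
                (r * σ ^ 3) ^ 2 * |deriv (deriv (deriv F)) (r * σ ^ 3)| := by
              rw [abs_mul (2 * (r * σ ^ 3)) (deriv (deriv F) (r * σ ^ 3)),
                abs_mul ((r * σ ^ 3) ^ 2) (deriv (deriv (deriv F)) (r * σ ^ 3)),
                abs_of_nonneg (by positivity : (0:ℝ) ≤ 2 * (r * σ ^ 3)), abs_of_nonneg (sq_nonneg (r * σ ^ 3))]
          _ ≤ η₀ * M₂ + η₀ ^ 2 * M₃ :=
              add_le_add (mul_le_mul h2η b2 (abs_nonneg _) hη₀.le)
                (mul_le_mul hη2 b3 (abs_nonneg _) (sq_nonneg _))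
      calc (r * σ ^ 3) * |2 * (r * σ ^ 3) * deriv (deriv F) (r * σ ^ 3) +
            (r * σ ^ 3) ^ 2 * deriv (deriv (deriv F)) (r * σ ^ 3)|
          ≤ (r * σ ^ 3) * (η₀ * M₂ + η₀ ^ 2 * M₃) := mul_le_mul_of_nonneg_left h1 hη0
        _ ≤ (M₁ + η₀ * M₂ + η₀ ^ 2 * M₃) * (r * σ ^ 3) := by nlinarith [mul_nonneg hη0 hM₁]

end Summit.AtomisticToContinuum.HydrodynamicLimit.Theorems

end
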